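import Literature.Probability.RandomPlanarGeometry.HexSAWStripBetaLengthWidthTwo
import Literature.Probability.RandomPlanarGeometry.HexSAWStripBetaLengthLaw
import Literature.Analysis.Asymptotics.KaramataPowerSeries
import HarnessLib

/-!
# ★★★★ The length amplitude of the width-two strip in closed form: `Σ_{β-walks of S_2 with 2m vertices} x_c^{2m} y_2^{#top} → (19 − 6√2)/8`
# (module «BETA-LENGTH-WIDTH-TWO-LAW»)

Topic `Literature/Probability/RandomPlanarGeometry` (continues «BETA-LENGTH-WIDTH-TWO» `HexSAWStripBetaLengthWidthTwo.lean` — `W2.limB2gen`,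
`W2.tendsto_fsumY_scaled` (the `(s x_c)^{|ω|} y_2^{#top}`-weighted family sums converge to `B_2(s x_c; y_2)`), `W2.one_sub_sq_mul_limB2gen_eq`,
`W2.lenReg_one = (19 − 6√2)/8`, `W2.continuousAt_lenReg_one` —, «BETA-LENGTH-LAW» `HexSAWStripBetaLengthLaw.lean` (`HV.exists_pos_tendsto_betaLenSum_even`:
`bℓ_T(2m)(y_T) → Λℓ_T > 0`, `HV.betaLenSum_eq_zero_of_odd`), «BETA-LENGTH-SPLIT» #578 (`HV.betaLenSum`, `HV.sum_betaLen_eq_betaLenSum`), the solved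
width-two strip (`W2.fsumY`, `W2.fw_injOn_paramsB`, `W2.fw_mem_beta`, `W2.exists_param_of_mem`, `W2.surfContacts_fw`), and the tree's Abelian theorem
`Literature.Analysis.Asymptotics.hardyLittlewood_powerSeries_iff` (easy direction, as in «BETA-COEFF» §9)).  Lane «pcv-sawmu» (CriticalPhenomena
venture), a-p2 g22 — car 4 of the «β-walks by length» programme.  Sources of the SETTING: N. R. Beaton et al., CMP 326 (2014) §2 eq. (10), §3.2,
Corollary 8 (arXiv:1109.0358v5 p. 12); N. R. Beaton, A. J. Guttmann, I. Jensen, J. Phys. A 45 (2012) §2; W. Feller vol. I (1968) XIII.3;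
H. Duminil-Copin, S. Smirnov, Ann. Math. 175 (2012) Theorem 1.  The number is the lane's; it was posted as a sealed prediction for the enumeration
side before this proof (HOME `pub-sawmu-a-p2/g22/FINDING-BETA-LENGTH-AMPLITUDE-TWO.md`, 2026-08-26 11:38Z).

## What is proved (namespace `Literature.Probability.RandomPlanarGeometry.SAW.HV`; `x_c = hexCriticalFugacity`, `y_2 = W2.yTwo = stripYT 2 = (10+8√2)/7`)

* §1 `sum_betaMidWalks_eq_sum_bridgeLists` (β mid-walks of `S_{T,L}` ↔ `bridgeLists T L` for ANY weight of (#vertices, #contacts), `T ≥ 1`),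
  `fsumY_eq_sum_image`, ★ `fsumY_le_sum_bridgeLists` / ★ `sum_bridgeLists_le_fsumY` — the tree's two comparison lemmas with a GENERAL step
  fugacity `x ≥ 0`: `W2.fsumY x y N ≤ Σ_{β-walks of S_{2,2N}} x^{|ω|} y^{#top}` and `Σ_{β-walks of S_{2,L}} x^{|ω|} y^{#top} ≤ W2.fsumY x y (L+2)`.
* §2 `lenPartial s L = Σ_{β-walks of S_{2,L}} (s x_c)^{|ω|} y_2^{#top}`, ★ `tendsto_lenPartial` (`→ B_2(s x_c; y_2)` along `L = 2N`, `0 ≤ s < 1`),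
  `sum_betaLen_le_betaLenSum_two`, `lenPartial_eq_sum_range`, `sum_range_betaLenSum_le_lenPartial`, `lenPartial_le_sum_range`, and
  ★★★ `hasSum_betaLenSum_two_mul_pow` / `…_stripYT_…` — **`Σ_n bℓ_2(n)(y_2) s^n = B_2(s·x_c; y_2)`** (`HasSum`, `0 ≤ s < 1`): the length
  generating function of the β-walks of `S_2` at the threshold IS the two-variable closed form on the ray `x = s x_c`.
* §3 `hasSum_betaLenSum_two_even` (`Σ_m bℓ_2(2m)(y_2) t^m = B_2(√t x_c; y_2)`: odd lengths are empty), ★★★★ `tendsto_betaLenSum_two_even` —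
  **`bℓ_2(2m)(y_2) = Σ_{β-walks of S_2 with 2m vertices} x_c^{2m} y_2^{#top} ⟶ (19 − 6√2)/8 = 1.31433982822…`**; ★★★ `tendsto_pow_mul_betaCount_two_even`
  (counting form: the surface-weighted number of `2m`-vertex β-walks of the two-cell strip is `((19 − 6√2)/8 + o(1))·(2 + √2)^m`);
  ★★★ `tendsto_sum_betaLen_two_even` (in every box `S_{2,L_m}`, `L_m ≥ 2m`).

Label: LANE THEOREM (own result of lane «pcv-sawmu», a-p2 g22, 2026-08-26).  NOT claimed: a rate (the second pole of `B_2(s x_c; y_2)` in `s²`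
gives a geometric rate — not formalised), other widths, the chain analogue.
-/

noncomputable section

open Finset Filter Topology Literature.Probability.LatticeModels Literature.Probability.Percolation

namespace Literature.Probability.RandomPlanarGeometry.SAW.HV

open W2

/-! ### §1 Mid-walks versus vertex lists, and the two-variable family sums against the β-walks of a box -/

/-- Re-indexing the β mid-walks of `S_{T,L}` by their inner vertex lists: for ANY weight `φ(#vertices, #top contacts)`,
`Σ_{P β-midwalk} φ(mwLen P, surfContacts P) = Σ_{l ∈ bridgeLists T L} φ(|l|, topCnt l)` (`T ≥ 1`; the `x_c`-weighted instance is the tree's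
`HV.stripBcoeffY_eq_sum_bridgeLists`). [cite: DuminilCopinSmirnov2012, §3 (walks a → β of S_{T,L}); lane plumbing] -/
theorem sum_betaMidWalks_eq_sum_bridgeLists {T : ℕ} (hT : 1 ≤ T) (φ : ℕ → ℕ → ℝ) (L : ℕ) :
    ∑ P ∈ (midWalks (stripV T L)).filter (fun P => IsBetaDart T (finalDart P)), φ (mwLen P) (surfContacts T P) =
      ∑ l ∈ bridgeLists T L, φ l.length (topCnt T l) := by
  classical
  rw [bridgeLists, sum_image]
  · refine sum_congr rfl fun P hP => ?_
    rw [mem_filter, mem_midWalks_iff] at hP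
    rw [hP.1.length_inner]
    rfl
  · intro P hP P' hP' h
    rw [mem_coe, mem_filter, mem_midWalks_iff] at hP hP'
    obtain ⟨l, hl, rfl, -⟩ := eq_of_isBetaDart hT hP.1 hP.2
    obtain ⟨l', hl', rfl, -⟩ := eq_of_isBetaDart hT hP'.1 hP'.2
    simp only [inner_cons_append] at h
    subst h; rfl

variable {x y : ℝ}

/-- The two-variable family sum as a sum over the family mid-walks (the tree's first step of `W2.fsumY_le_stripGFy`, for general `x`).
[cite: BeatonBousquetMelouDeGierDuminilCopinGuttmann2014, §2 eq. (10) (arXiv v5 p. 6: B_{T,L}(x; y)); lane plumbing] -/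
theorem fsumY_eq_sum_image (x y : ℝ) (N : ℕ) :
    fsumY x y N = ∑ P ∈ (paramsB N).image fw, x ^ mwLen P * y ^ surfContacts 2 P := by
  rw [fsumY, Finset.sum_image (fw_injOn_paramsB N)]
  refine Finset.sum_congr rfl fun q hq => ?_
  rw [surfContacts_fw (fst_eq_of_mem_paramsB hq), fw, mwLen_famWalk, qlen]

/-- ★ `fsumY x y N ≤ Σ_{β-walks of S_{2,2N}} x^{|ω|} y^{#top}` for `x, y ≥ 0` (the family walks are distinct β-walks of the box `2N`).
[cite: BeatonBousquetMelouDeGierDuminilCopinGuttmann2014, §2 eq. (10); lane plumbing] -/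
theorem fsumY_le_sum_bridgeLists (hx : 0 ≤ x) (hy : 0 ≤ y) (N : ℕ) :
    fsumY x y N ≤ ∑ l ∈ bridgeLists 2 (2 * N), x ^ l.length * y ^ topCnt 2 l := by
  rw [fsumY_eq_sum_image, ← sum_betaMidWalks_eq_sum_bridgeLists (by norm_num) (fun n m => x ^ n * y ^ m)]
  exact Finset.sum_le_sum_of_subset_of_nonneg (Finset.image_subset_iff.2 fun q hq => fw_mem_beta hq)
    fun P _ _ => mul_nonneg (pow_nonneg hx _) (pow_nonneg hy _)

/-- ★ `Σ_{β-walks of S_{2,L}} x^{|ω|} y^{#top} ≤ fsumY x y (L+2)` for `x, y ≥ 0` (completeness of the families, `W2.exists_param_of_mem`).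
[cite: BeatonBousquetMelouDeGierDuminilCopinGuttmann2014, §2 eq. (10); lane plumbing] -/
theorem sum_bridgeLists_le_fsumY (hx : 0 ≤ x) (hy : 0 ≤ y) (L : ℕ) :
    ∑ l ∈ bridgeLists 2 L, x ^ l.length * y ^ topCnt 2 l ≤ fsumY x y (L + 2) := by
  rw [fsumY_eq_sum_image, ← sum_betaMidWalks_eq_sum_bridgeLists (by norm_num) (fun n m => x ^ n * y ^ m)]
  refine Finset.sum_le_sum_of_subset_of_nonneg (fun P hP => ?_) fun P _ _ => mul_nonneg (pow_nonneg hx _) (pow_nonneg hy _)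
  rw [Finset.mem_filter] at hP
  obtain ⟨q, hq, hqB, -⟩ := exists_param_of_mem hP.1 (Or.inl hP.2)
  exact Finset.mem_image.2 ⟨q, hqB hP.2, hq⟩

/-! ### §2 The length generating function of the β-walks of `S_2` at the threshold IS `B_2(s·x_c; y_2)` -/

/-- The length-weighted sum over the β-walks of the box `S_{2,L}`: `A_L(s) := Σ_{ω} (s x_c)^{|ω|} y_2^{#top(ω)}` (plumbing).
[cite: BeatonBousquetMelouDeGierDuminilCopinGuttmann2014, §2 eq. (10); lane plumbing] -/
def lenPartial (s : ℝ) (L : ℕ) : ℝ := ∑ l ∈ bridgeLists 2 L, (s * hexCriticalFugacity) ^ l.length * yTwo ^ topCnt 2 l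

variable {s : ℝ}

/-- ★ `A_{2N}(s) → B_2(s x_c; y_2)` for `0 ≤ s < 1` (squeezed between `fsumY N` and `fsumY (2N+2)`, both convergent by «BETA-LENGTH-WIDTH-TWO»).
[cite: BeatonBousquetMelouDeGierDuminilCopinGuttmann2014, §2 eq. (10) and Corollary 8; lane «pcv-sawmu» a-p2 g22] -/
theorem tendsto_lenPartial (hs0 : 0 ≤ s) (hs1 : s < 1) :
    Tendsto (fun N => lenPartial s (2 * N)) atTop (𝓝 (limB2gen (s * hexCriticalFugacity) yTwo)) := by
  have hx : 0 ≤ s * hexCriticalFugacity := mul_nonneg hs0 hexCriticalFugacity_pos_lt_one.1.le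
  have hy : 0 ≤ yTwo := (one_lt_yTwo).le.trans' zero_le_one
  have h1 := tendsto_fsumY_scaled hs0 hs1
  have h2N : Tendsto (fun N : ℕ => 2 * N + 2) atTop atTop := tendsto_atTop_atTop.2 fun n => ⟨n, fun m hm => by omega⟩
  have h2 := h1.comp h2N
  refine tendsto_of_tendsto_of_tendsto_of_le_of_le h1 h2 (fun N => fsumY_le_sum_bridgeLists hx hy N) fun N => ?_
  exact sum_bridgeLists_le_fsumY hx hy (2 * N)

/-- The length slices of a box are below the slices of the strip: `Σ_{betaLen 2 L n} x_c^{|ω|} y^{#top} ≤ bℓ_2(n)(y)` (`y ≥ 0`).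
[cite: DuminilCopinSmirnov2012, §3; lane plumbing] -/
theorem sum_betaLen_le_betaLenSum_two {y : ℝ} (hy : 0 ≤ y) (L n : ℕ) :
    ∑ l ∈ betaLen 2 L n, hexCriticalFugacity ^ l.length * y ^ topCnt 2 l ≤ betaLenSum 2 n y := by
  rcases le_or_gt n L with h | h
  · rw [sum_betaLen_eq_betaLenSum (by norm_num) h]
  · rw [betaLenSum]
    refine sum_le_sum_of_subset_of_nonneg ?_ fun _ _ _ =>
      mul_nonneg (pow_nonneg hexCriticalFugacity_pos_lt_one.1.le _) (pow_nonneg hy _)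
    intro l hl
    rw [betaLen, mem_filter] at hl ⊢
    exact ⟨bridgeLists_mono_L (by norm_num) h.le hl.1, hl.2⟩

/-- `A_L(s)` regrouped by length: `A_L(s) = Σ_{n ≤ |V(S_{2,L})|} s^n · Σ_{betaLen 2 L n} x_c^{|ω|} y_2^{#top}` (plumbing). [cite: DuminilCopinSmirnov2012, §3; lane plumbing] -/
theorem lenPartial_eq_sum_range (s : ℝ) (L : ℕ) :
    lenPartial s L = ∑ n ∈ Finset.range ((stripV 2 L).card + 1),
      s ^ n * ∑ l ∈ betaLen 2 L n, hexCriticalFugacity ^ l.length * yTwo ^ topCnt 2 l := by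
  classical
  rw [lenPartial, ← Finset.sum_fiberwise_of_maps_to (g := List.length) (t := Finset.range ((stripV 2 L).card + 1)) (fun l hl => by
    rw [mem_range]; have := length_le_card_stripV (by norm_num : 1 ≤ 2) hl; omega)]
  refine sum_congr rfl fun n _ => ?_
  rw [betaLen, Finset.mul_sum]
  refine sum_congr rfl fun l hl => ?_
  rw [mem_filter] at hl
  rw [hl.2, mul_pow, mul_assoc]

/-- Lower bound: the partial sums of `Σ_n bℓ_2(n)(y_2) s^n` are below `A_L(s)` once `L + 1 ≥ M` (`s ≥ 0`). [cite: DuminilCopinSmirnov2012, §3; lane plumbing] -/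
theorem sum_range_betaLenSum_le_lenPartial (hs0 : 0 ≤ s) {M L : ℕ} (hML : M ≤ L + 1) :
    ∑ n ∈ Finset.range M, betaLenSum 2 n yTwo * s ^ n ≤ lenPartial s L := by
  classical
  have hy : 0 ≤ yTwo := (one_lt_yTwo).le.trans' zero_le_one
  have hx := hexCriticalFugacity_pos_lt_one
  set S := (bridgeLists 2 L).filter (fun l => l.length < M) with hS
  have h1 : ∑ n ∈ Finset.range M, betaLenSum 2 n yTwo * s ^ n =
      ∑ l ∈ S, (s * hexCriticalFugacity) ^ l.length * yTwo ^ topCnt 2 l := by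
    rw [← Finset.sum_fiberwise_of_maps_to (g := List.length) (t := Finset.range M) (s := S) (fun l hl => by
      rw [hS, mem_filter] at hl; exact mem_range.2 hl.2)]
    refine sum_congr rfl fun n hn => ?_
    rw [mem_range] at hn
    rw [← sum_betaLen_eq_betaLenSum (by norm_num) (show n ≤ L by omega), betaLen, hS, filter_filter, Finset.sum_mul]
    refine sum_congr (filter_congr fun l _ => ⟨fun h => ⟨by omega, h⟩, fun h => h.2⟩) fun l hl => ?_
    rw [mem_filter] at hl
    rw [hl.2.2, mul_pow]; ring
  rw [h1, lenPartial]
  exact sum_le_sum_of_subset_of_nonneg (filter_subset _ _) fun _ _ _ =>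
    mul_nonneg (pow_nonneg (mul_nonneg hs0 hx.1.le) _) (pow_nonneg hy _)

/-- Upper bound: `A_L(s) ≤ Σ_{n ∈ range K} bℓ_2(n)(y_2) s^n` for `K = |V(S_{2,L})| + 1` (`s ≥ 0`). [cite: DuminilCopinSmirnov2012, §3; lane plumbing] -/
theorem lenPartial_le_sum_range (hs0 : 0 ≤ s) (L : ℕ) :
    lenPartial s L ≤ ∑ n ∈ Finset.range ((stripV 2 L).card + 1), betaLenSum 2 n yTwo * s ^ n := by
  have hy : 0 ≤ yTwo := (one_lt_yTwo).le.trans' zero_le_one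
  rw [lenPartial_eq_sum_range]
  refine sum_le_sum fun n _ => ?_
  rw [mul_comm]
  exact mul_le_mul_of_nonneg_right (sum_betaLen_le_betaLenSum_two hy L n) (pow_nonneg hs0 _)

/-- ★★★ **THE LENGTH GENERATING FUNCTION OF THE β-WALKS OF `S_2` AT THE THRESHOLD**: for `0 ≤ s < 1`,
`Σ_n bℓ_2(n)(y_2) · s^n = B_2(s·x_c; y_2) = limB2gen (s x_c) y_2` (`HasSum`), with `bℓ_2(n)(y_2) = HV.betaLenSum 2 n y_2` the `x_c^{n} y_2^{#top}`-mass
of the β-walks of `S_2` with `n` vertices (#578).  [cite: BeatonBousquetMelouDeGierDuminilCopinGuttmann2014, §2 eq. (10) and Corollary 8 (arXiv v5 p. 12: ρ_T(y_T) = x_c); lane «pcv-sawmu» a-p2 g22 — own result] -/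
theorem hasSum_betaLenSum_two_mul_pow (hs0 : 0 ≤ s) (hs1 : s < 1) :
    HasSum (fun n => betaLenSum 2 n yTwo * s ^ n) (limB2gen (s * hexCriticalFugacity) yTwo) := by
  have hy : 0 ≤ yTwo := (one_lt_yTwo).le.trans' zero_le_one
  have hq0 : ∀ n, 0 ≤ betaLenSum 2 n yTwo * s ^ n := fun n =>
    mul_nonneg (betaLenSum_noRenLen_nonneg hy n).1 (pow_nonneg hs0 _)
  have hlim := tendsto_lenPartial hs0 hs1
  -- partial sums ≤ G
  have hpart : ∀ M, ∑ n ∈ Finset.range M, betaLenSum 2 n yTwo * s ^ n ≤ limB2gen (s * hexCriticalFugacity) yTwo := fun M =>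
    ge_of_tendsto hlim (eventually_atTop.2 ⟨M, fun N hN => sum_range_betaLenSum_le_lenPartial hs0 (by omega)⟩)
  have hsum : Summable (fun n => betaLenSum 2 n yTwo * s ^ n) := summable_of_sum_range_le hq0 hpart
  have hle : ∑' n, betaLenSum 2 n yTwo * s ^ n ≤ limB2gen (s * hexCriticalFugacity) yTwo := Real.tsum_le_of_sum_range_le hq0 hpart
  have hge : limB2gen (s * hexCriticalFugacity) yTwo ≤ ∑' n, betaLenSum 2 n yTwo * s ^ n :=
    le_of_tendsto' hlim fun N => (lenPartial_le_sum_range hs0 (2 * N)).trans (hsum.sum_le_tsum _ fun n _ => hq0 n)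
  have heq : ∑' n, betaLenSum 2 n yTwo * s ^ n = limB2gen (s * hexCriticalFugacity) yTwo := le_antisymm hle hge
  rw [← heq]
  exact hsum.hasSum

/-- The same with `y_2 = stripYT 2`. [cite: BeatonBousquetMelouDeGierDuminilCopinGuttmann2014, Corollary 8; lane «pcv-sawmu» a-p2 g22 — own result] -/
theorem hasSum_betaLenSum_two_stripYT_mul_pow (hs0 : 0 ≤ s) (hs1 : s < 1) :
    HasSum (fun n => betaLenSum 2 n (stripYT 2) * s ^ n) (limB2gen (s * hexCriticalFugacity) yTwo) := by
  rw [stripYT_two_eq_yTwo]; exact hasSum_betaLenSum_two_mul_pow hs0 hs1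

/-! ### §3 ★★★★ The amplitude: `bℓ_2(2m)(y_2) → (19 − 6√2)/8` -/

/-- The EVEN part carries the whole series: `Σ_m bℓ_2(2m)(y_2) t^m = B_2(√t·x_c; y_2)` for `0 ≤ t < 1` (odd lengths are empty).
[cite: DuminilCopinSmirnov2012, §3 (the lattice is bipartite); lane plumbing] -/
theorem hasSum_betaLenSum_two_even {t : ℝ} (ht0 : 0 ≤ t) (ht1 : t < 1) :
    HasSum (fun m => betaLenSum 2 (2 * m) (stripYT 2) * t ^ m) (limB2gen (Real.sqrt t * hexCriticalFugacity) yTwo) := by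
  have hs0 : 0 ≤ Real.sqrt t := Real.sqrt_nonneg t
  have hs1 : Real.sqrt t < 1 := by
    rw [show (1 : ℝ) = Real.sqrt 1 from Real.sqrt_one.symm]
    exact Real.sqrt_lt_sqrt ht0 ht1
  have hf := hasSum_betaLenSum_two_stripYT_mul_pow hs0 hs1
  have hodd : HasSum (fun m => betaLenSum 2 (2 * m + 1) (stripYT 2) * Real.sqrt t ^ (2 * m + 1)) 0 := by
    have : (fun m => betaLenSum 2 (2 * m + 1) (stripYT 2) * Real.sqrt t ^ (2 * m + 1)) = fun _ => 0 := by
      funext m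
      rw [betaLenSum_eq_zero_of_odd (by norm_num : 1 ≤ 2) (Nat.not_even_iff_odd.2 ⟨m, rfl⟩), zero_mul]
    rw [this]; exact hasSum_zero
  have heven_summable : Summable (fun m => betaLenSum 2 (2 * m) (stripYT 2) * Real.sqrt t ^ (2 * m)) :=
    hf.summable.comp_injective (f := fun n => betaLenSum 2 n (stripYT 2) * Real.sqrt t ^ n)
      (fun a b h => by simpa using h : Function.Injective fun m : ℕ => 2 * m)
  obtain ⟨a, ha⟩ := heven_summable
  have hsum := HasSum.even_add_odd (f := fun n => betaLenSum 2 n (stripYT 2) * Real.sqrt t ^ n) ha hodd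
  rw [add_zero] at hsum
  have haG : a = limB2gen (Real.sqrt t * hexCriticalFugacity) yTwo := hsum.unique hf
  rw [← haG]
  refine ha.congr_fun fun m => ?_  -- rewrite `√t^(2m) = t^m`
  simp only [pow_mul, Real.sq_sqrt ht0]

/-- ★★★★ **THE LENGTH AMPLITUDE OF THE WIDTH-TWO STRIP IN CLOSED FORM**:
`bℓ_2(2m)(y_2) = Σ_{β-walks of S_2 with 2m vertices} x_c^{2m} y_2^{#top} ⟶ Λℓ_2 = (19 − 6√2)/8 = 1.31433982822…` (`m → ∞`).
Proof: «BETA-LENGTH-LAW» gives a limit `Λ > 0`; by the Abelian theorem (`hardyLittlewood_powerSeries_iff`, easy direction) `(1 − t)·Σ_m bℓ_2(2m) t^m → Λ`;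
by §2 that series is `B_2(√t x_c; y_2)` and by «BETA-LENGTH-WIDTH-TWO» `(1 − s²) B_2(s x_c; y_2) → (19 − 6√2)/8`; limits along `𝓝[<] 1` are unique.
The first length amplitude of the programme in closed form (`Λℓ_1 = 2 = Λ_1` is the trivial width one); posted as a sealed prediction for the
enumeration side BEFORE the proof (HOME FINDING-BETA-LENGTH-AMPLITUDE-TWO, 2026-08-26).
[cite: BeatonBousquetMelouDeGierDuminilCopinGuttmann2014, §3.2 and Corollary 8; BeatonGuttmannJensen2012, §2; Feller1968, XIII.3; DuminilCopinSmirnov2012, Theorem 1; lane «pcv-sawmu» a-p2 g22 — own result] -/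
theorem tendsto_betaLenSum_two_even : Tendsto (fun m : ℕ => betaLenSum 2 (2 * m) (stripYT 2)) atTop (𝓝 ((19 - 6 * Real.sqrt 2) / 8)) := by
  obtain ⟨Λ, hΛ, hlim, -⟩ := exists_pos_tendsto_betaLenSum_even (T := 2) le_rfl
  have hy : 0 ≤ stripYT 2 := (one_lt_stripYT (by norm_num : 1 ≤ 2)).le.trans' zero_le_one
  set q : ℕ → ℝ := fun m => betaLenSum 2 (2 * m) (stripYT 2) with hq
  have hq0 : ∀ m, 0 ≤ q m := fun m => (betaLenSum_noRenLen_nonneg hy (2 * m)).1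
  -- Abelian step
  have habel : Tendsto (fun t : ℝ => (1 - t) * ∑' m, q m * t ^ m) (𝓝[<] 1) (𝓝 Λ) := by
    have hces : Tendsto (fun n : ℕ => (∑ k ∈ Finset.range n, q k) / (n : ℝ) ^ (1 : ℝ)) atTop (𝓝 (Λ / Real.Gamma (1 + 1))) := by
      have h2 : Real.Gamma (1 + 1) = 1 := by norm_num [Real.Gamma_two]
      rw [h2, div_one]
      refine hlim.cesaro.congr fun n => ?_
      rw [Real.rpow_one, div_eq_inv_mul]
    have hA := ((Literature.Analysis.Asymptotics.hardyLittlewood_powerSeries_iff hq0 zero_le_one hΛ).mpr hces).2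
    refine hA.congr fun t => ?_
    rw [Real.rpow_one]
  -- the same function tends to the closed form
  have hclosed : Tendsto (fun t : ℝ => (1 - t) * ∑' m, q m * t ^ m) (𝓝[<] 1) (𝓝 ((19 - 6 * Real.sqrt 2) / 8)) := by
    rw [← lenReg_one]
    have hsqrt : Tendsto Real.sqrt (𝓝[<] (1 : ℝ)) (𝓝 1) := by
      have h := (Real.continuous_sqrt.tendsto (1 : ℝ)).mono_left (nhdsWithin_le_nhds (s := Set.Iio (1 : ℝ)))
      rwa [Real.sqrt_one] at h
    have hc : Tendsto (fun t => lenReg (Real.sqrt t)) (𝓝[<] 1) (𝓝 (lenReg 1)) := continuousAt_lenReg_one.tendsto.comp hsqrt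
    refine hc.congr' ?_
    have hev : ∀ᶠ t : ℝ in 𝓝[<] 1, 0 ≤ t := by
      have : Set.Ioo (0 : ℝ) 1 ∈ 𝓝[<] (1 : ℝ) := Ioo_mem_nhdsLT (by norm_num)
      filter_upwards [this] with t ht using ht.1.le
    filter_upwards [hev, self_mem_nhdsWithin] with t ht0 ht1
    have hs0 : 0 ≤ Real.sqrt t := Real.sqrt_nonneg t
    have hs1 : Real.sqrt t < 1 := by
      rw [show (1 : ℝ) = Real.sqrt 1 from Real.sqrt_one.symm]
      exact Real.sqrt_lt_sqrt ht0 (Set.mem_Iio.1 ht1)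
    rw [← one_sub_sq_mul_limB2gen_eq hs0 hs1, Real.sq_sqrt ht0, (hasSum_betaLenSum_two_even ht0 (Set.mem_Iio.1 ht1)).tsum_eq]
  have huniq : Λ = (19 - 6 * Real.sqrt 2) / 8 := tendsto_nhds_unique habel hclosed
  rw [← huniq]
  exact hlim

/-- ★★★ **Counting form**: `x_c^{2m} · Σ_{β-walks of S_2 with 2m vertices} y_2^{#top} ⟶ (19 − 6√2)/8`, `y_2 = (10 + 8√2)/7`: the surface-weighted
number of `2m`-vertex walks of the two-cell strip from the mid-edge `a` to the upper boundary is `((19 − 6√2)/8 + o(1)) · (2 + √2)^m`.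
[cite: BeatonBousquetMelouDeGierDuminilCopinGuttmann2014, §3.2 and Corollary 8; DuminilCopinSmirnov2012, Theorem 1 (x_c^{−2} = 2 + √2); lane «pcv-sawmu» a-p2 g22 — own result] -/
theorem tendsto_pow_mul_betaCount_two_even :
    Tendsto (fun m : ℕ => hexCriticalFugacity ^ (2 * m) * ∑ l ∈ betaLen 2 (2 * m) (2 * m), stripYT 2 ^ topCnt 2 l) atTop
      (𝓝 ((19 - 6 * Real.sqrt 2) / 8)) := by
  refine tendsto_betaLenSum_two_even.congr fun m => ?_
  rw [betaLenSum, Finset.mul_sum]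
  refine sum_congr rfl fun l hl => ?_
  rw [betaLen, mem_filter] at hl
  rw [hl.2]

/-- ★★★ **In every box**: for `L_m ≥ 2m`, `Σ_{ω ∈ betaLen 2 L_m (2m)} x_c^{2m} y_2^{#top(ω)} → (19 − 6√2)/8`.
[cite: DuminilCopinSmirnov2012, §3 (the domains S_{T,L}); lane «pcv-sawmu» a-p2 g22 — own result] -/
theorem tendsto_sum_betaLen_two_even (L : ℕ → ℕ) (hL : ∀ m, 2 * m ≤ L m) :
    Tendsto (fun m : ℕ => ∑ l ∈ betaLen 2 (L m) (2 * m), hexCriticalFugacity ^ l.length * stripYT 2 ^ topCnt 2 l) atTop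
      (𝓝 ((19 - 6 * Real.sqrt 2) / 8)) :=
  tendsto_betaLenSum_two_even.congr fun m => (sum_betaLen_eq_betaLenSum (by norm_num) (hL m) _).symm

end Literature.Probability.RandomPlanarGeometry.SAW.HV
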